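import Literature.Probability.RandomPlanarGeometry.HexSAWVirginizationCut
import HarnessLib

/-!
# Virginization (III): the rooted reduction

Continuation of `HexSAWVirginizationCut.lean` (companion of the chordal reduction
`sum_vertexTraversals_le_chordal` of `HexSAWVirginizationChordal.lean`).
`sum_vertexTraversals_le_rooted`: the endpoint `b` is DEEP inside the lattice disc while `a` is far;
the hypothesis is about the RADIAL class of self-avoiding arcs of `Λ' ∖ {b}` from a door of the
`N`-circle to the mid-edge `{q, b}` through which they step into `b`. Cut each SAW of the event at
its first vertex in the closed `N`-disc (domain Markov property, Duminil-Copin–Smirnov 2012 §2,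
`sum_fibre_event_le`); the final piece up to the predecessor of `b` is such an arc and the event
transports to it (AB99 §3.a; the last half-edge moves the endpoint by `≤ 1/2`). No new definitions.
-/

noncomputable section

open scoped Classical
open Literature.Probability.LatticeModels

namespace Literature.Probability.RandomPlanarGeometry.SAW

/-! ### The rooted reduction -/

section Rooted

variable {Ω : Set ℂ} {δ : ℝ} {a b : HexVertex}

/-- The midpoint of an edge of `ℍ` is within `1/2` of its endpoints (given the edge length
bound). [folklore] -/
theorem dist_hexCenter_hexMidpoint_le {q b : HexVertex}
    (h : dist (hexCenter q) (hexCenter b) ≤ 1) : dist (hexCenter b) (hexMidpoint s(q, b)) ≤ 1 / 2 := by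
  rw [hexMidpoint_mk, dist_eq_norm,
    show hexCenter b - (hexCenter q + hexCenter b) / 2 = (2 : ℂ)⁻¹ * (hexCenter b - hexCenter q) by ring,
    norm_mul, norm_inv, Complex.norm_ofNat, ← dist_eq_norm, dist_comm]
  linarith

/-- **Virginization, rooted case.** As `sum_vertexTraversals_le_chordal`, but now the endpoint
`b` is DEEP (`dist (c b) z₀ ≤ n`) while `a` is far, and the hypothesis is about the RADIAL class:
arcs of `Λ' ∖ {b}` from a door `m` on the `N`-circle to the mid-edge `{q, b}` through which they
step into `b` (`q ∼ b` in `Ω_δ`), for every `Λ'` containing the cells of the open `N`-disc. Cut each SAW of the event at its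
first vertex in `B̄(z₀, N)`; the final piece up to the predecessor of `b` is such an arc, and the
event transports to it (the last half-edge moves the endpoint by `≤ 1/2`).
[cite: DuminilCopinSmirnov2012, §2 (walks between mid-edges)] -/
theorem sum_vertexTraversals_le_rooted [Fintype (HexDomainSAW Ω δ a b)] {z₀ : ℂ}
    {N n r R C x : ℝ} {k₀ : ℕ}
    (Λ₀ : Finset HexVertex) (hΛ₀ : ∀ (ω : HexDomainSAW Ω δ a b), ∀ v ∈ ω.walk.support, v ∈ Λ₀)
    (hdisc : ∀ v : HexVertex, dist (hexCenter v) z₀ < N → v ∈ Λ₀)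
    (hsupp : ∀ (ω : HexDomainSAW Ω δ a b), ∀ v ∈ ω.walk.support,
      v ∈ embMeshDomain hexGraph hexCenter Ω δ)
    (hx : 0 ≤ x) (hC : 0 ≤ C)
    (hrR : r + 1 < R) (hrn : r + 1 ≤ n) (hNR : N / 2 + 1 ≤ R) (hRN : R + 1 ≤ N) (hnN : n ≤ N)
    (hedge : ∀ u v : HexVertex, hexGraph.Adj u v → dist (hexCenter u) (hexCenter v) ≤ 1)
    (ha : N < dist (hexCenter a) z₀) (hb : dist (hexCenter b) z₀ ≤ n)
    (hRoot : ∀ (Λ' : Finset HexVertex) (m : Sym2 HexVertex) (q : HexVertex),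
      (∀ v : HexVertex, dist (hexCenter v) z₀ < N → v ∈ Λ') →
      (∃ u c : HexVertex, m = s(u, c) ∧ hexGraph.Adj u c ∧ u ∉ Λ' ∧ c ∈ Λ' ∧
        c ∈ embMeshDomain hexGraph hexCenter Ω δ ∧ dist (hexCenter c) z₀ ≤ N ∧
        N < dist (hexCenter u) z₀) →
      (hexDomainGraph Ω δ).Adj q b →
      ∑ α : HexMidEdgeSAW (Λ'.erase b) m s(q, b), (if α.verts.IsChain (hexDomainGraph Ω δ).Adj ∧
          (⟨polyline α.points⟩ : Curve ℂ).HasTraversals k₀ z₀ n (N / 2) then x ^ α.length else 0) ≤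
        C * ∑ α : HexMidEdgeSAW (Λ'.erase b) m s(q, b),
          (if α.verts.IsChain (hexDomainGraph Ω δ).Adj then x ^ α.length else 0)) :
    ∑ ω ∈ (Finset.univ : Finset (HexDomainSAW Ω δ a b)).filter (fun ω =>
        ∃ ι κ : Fin (2 * (k₀ + 1)) → Fin (ω.walk.support.map hexCenter).length, (∀ m, ι m ≤ κ m) ∧
          (∀ m, (dist ((ω.walk.support.map hexCenter).get (ι m)) z₀ ≤ r ∧
              R ≤ dist ((ω.walk.support.map hexCenter).get (κ m)) z₀) ∨
            (R ≤ dist ((ω.walk.support.map hexCenter).get (ι m)) z₀ ∧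
              dist ((ω.walk.support.map hexCenter).get (κ m)) z₀ ≤ r)) ∧
          ∀ ⦃m m'⦄, m < m' → κ m ≤ ι m'),
      x ^ ω.vertexCount ≤ C * ∑ ω : HexDomainSAW Ω δ a b, x ^ ω.vertexCount := by
  -- far / near (an opaque Boolean predicate)
  obtain ⟨far, hfar⟩ : ∃ far : HexVertex → Bool, ∀ v, far v = decide (N < dist (hexCenter v) z₀) :=
    ⟨_, fun _ => rfl⟩
  have hfar_iff : ∀ v, far v = true ↔ N < dist (hexCenter v) z₀ := fun v => by simp [hfar]
  have hfar_ff : ∀ v, far v = false ↔ dist (hexCenter v) z₀ ≤ N := fun v => by simp [hfar]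
  have hrN : r ≤ N := by linarith
  have hbN : dist (hexCenter b) z₀ ≤ N := hb.trans hnN
  -- the event, as an opaque predicate on vertex lists
  obtain ⟨EV, hEV⟩ : ∃ EV : List HexVertex → Prop, ∀ L, EV L ↔
      ∃ ι κ : Fin (2 * (k₀ + 1)) → Fin (L.map hexCenter).length, (∀ m, ι m ≤ κ m) ∧
        (∀ m, (dist ((L.map hexCenter).get (ι m)) z₀ ≤ r ∧ R ≤ dist ((L.map hexCenter).get (κ m)) z₀) ∨
          (R ≤ dist ((L.map hexCenter).get (ι m)) z₀ ∧ dist ((L.map hexCenter).get (κ m)) z₀ ≤ r)) ∧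
        ∀ ⦃m m'⦄, m < m' → κ m ≤ ι m' := ⟨_, fun _ => Iff.rfl⟩
  rw [Finset.filter_congr (fun ω _ => (hEV ω.walk.support).symm)]
  set S := (Finset.univ : Finset (HexDomainSAW Ω δ a b)).filter (fun ω => EV ω.walk.support)
    with hS
  -- the group map (opaque)
  obtain ⟨grp, hgrp⟩ : ∃ grp : HexDomainSAW Ω δ a b → List HexVertex × Option HexVertex ×
      Option HexVertex × Option HexVertex, ∀ ω, grp ω =
    ((ω.walk.support.takeWhile far).dropLast, (ω.walk.support.takeWhile far).getLast?,
      ((ω.walk.support.dropWhile far).dropLast).head?,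
      ((ω.walk.support.dropWhile far).dropLast).getLast?) := ⟨_, fun _ => rfl⟩
  -- every SAW of the event is near somewhere
  have hnear : ∀ ω ∈ S, ∃ v ∈ ω.walk.support, far v = false := fun ω _ =>
    ⟨b, ω.walk.end_mem_support, (hfar_ff b).2 hbN⟩
  -- the structure of the cut of a SAW of the event
  have hcut : ∀ ω ∈ S, ∃ (β₀ c : List HexVertex) (p₀ : HexVertex) (hc : c ≠ []),
      ω.walk.support = β₀ ++ p₀ :: (c ++ [b]) ∧
      grp ω = (β₀, some p₀, some (c.head hc), some (c.getLast hc)) ∧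
      (∀ v ∈ β₀ ++ [p₀], far v = true) ∧ far (c.head hc) = false := by
    intro ω hω
    have hL : ω.walk.support ≠ [] := ω.walk.support_ne_nil
    have hh : far (ω.walk.support.head hL) = true := by
      rw [SimpleGraph.Walk.head_support]; exact (hfar_iff a).2 ha
    obtain ⟨hβne, hrestne, hdec, hβfar, hresthead⟩ := decomp_far_rooted far hL hh (hnear ω hω)
    set β := ω.walk.support.takeWhile far with hβ
    set rest := ω.walk.support.dropWhile far with hrest
    have hrestlast : rest.getLast hrestne = b := by
      rw [← ω.walk.getLast_support]
      simp only [hdec]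
      exact (List.getLast_append_of_ne_nil _ hrestne).symm
    have hrest_eq : rest = rest.dropLast ++ [b] := by
      conv_lhs => rw [← List.dropLast_append_getLast hrestne, hrestlast]
    -- the middle piece is nonempty: otherwise a far list followed by `b` carries the event
    have hcne : rest.dropLast ≠ [] := by
      intro h0
      have hsupp : ω.walk.support = β ++ [b] := by rw [hdec, hrest_eq, h0, List.nil_append]
      have hE := (hEV _).1 (Finset.mem_filter.1 hω).2
      rw [hsupp, List.map_append, List.map_singleton] at hE
      exact not_vertexTraversals_far_append_singleton (by omega) (by linarith : r < R)
        (fun p hp => by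
          obtain ⟨v, hv, rfl⟩ := List.mem_map.1 hp
          have := (hfar_iff v).1 (hβfar v hv); linarith) hE
    refine ⟨β.dropLast, rest.dropLast, β.getLast hβne, hcne, ?_, ?_, ?_, ?_⟩
    · calc ω.walk.support = β ++ rest := hdec
        _ = (β.dropLast ++ [β.getLast hβne]) ++ (rest.dropLast ++ [b]) := by
            rw [List.dropLast_append_getLast, ← hrest_eq]
        _ = _ := by simp
    · rw [hgrp]
      simp only [← hβ, ← hrest, List.getLast?_eq_some_getLast hβne,
        List.head?_eq_some_head hcne, List.getLast?_eq_some_getLast hcne]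
    · intro v hv; rw [List.dropLast_append_getLast] at hv; exact hβfar v hv
    · obtain ⟨y, ys, hy⟩ := List.exists_cons_of_ne_nil hcne
      have h1 : rest = y :: (ys ++ [b]) := by rw [hrest_eq, hy]; rfl
      have h2 : rest.head hrestne = y := by simp only [h1, List.head_cons]
      have h3 : rest.dropLast.head hcne = y := by simp only [hy, List.head_cons]
      rw [h3, ← h2]; exact hresthead hrestne
  -- fibrewise
  rw [← Finset.sum_fiberwise_of_maps_to (fun ω hω => Finset.mem_image_of_mem grp hω)
    (s := S) (t := S.image grp)]
  have hnn : ∀ ω : HexDomainSAW Ω δ a b, 0 ≤ x ^ ω.vertexCount := fun ω => pow_nonneg hx _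
  -- the bound on each fibre
  have key : ∀ g ∈ S.image grp, ∑ ω ∈ S.filter (fun ω => grp ω = g), x ^ ω.vertexCount ≤
      C * ∑ ω ∈ Finset.univ.filter (fun ω => grp ω = g), x ^ ω.vertexCount := by
    intro g hg
    obtain ⟨ω₀, hω₀, rfl⟩ := Finset.mem_image.1 hg
    obtain ⟨β₀, c₀, p₀, hc₀, h₀, hg₀, hβfar, hc₁n⟩ := hcut ω₀ hω₀
    obtain ⟨c₁, hc₁⟩ : ∃ c₁, c₀.head hc₀ = c₁ := ⟨_, rfl⟩
    obtain ⟨q, hcL⟩ : ∃ q, c₀.getLast hc₀ = q := ⟨_, rfl⟩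
    rw [hc₁] at hg₀ hc₁n
    rw [hcL] at hg₀
    have hc₁mem : c₁ ∈ c₀ := hc₁ ▸ List.head_mem hc₀
    have hqmem : q ∈ c₀ := hcL ▸ List.getLast_mem hc₀
    -- facts about the witness
    have hnd : (β₀ ++ p₀ :: (c₀ ++ [b])).Nodup := h₀ ▸ ω₀.isPath.support_nodup
    have hchain : (β₀ ++ p₀ :: (c₀ ++ [b])).IsChain (hexDomainGraph Ω δ).Adj :=
      h₀ ▸ ω₀.walk.isChain_adj_support
    have e1 : ∀ c : List HexVertex, β₀ ++ p₀ :: (c ++ [b]) = (β₀ ++ [p₀]) ++ (c ++ [b]) :=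
      fun c => by simp
    have e2 : ∀ c : List HexVertex, β₀ ++ p₀ :: (c ++ [b]) = (β₀ ++ p₀ :: c) ++ [b] :=
      fun c => by simp
    have hadj₁ : hexGraph.Adj p₀ c₁ := by
      rw [e1] at hchain
      have := hchain.rel_getLast_head_of_append (by simp) (by simp [hc₀])
      simp only [List.getLast_append_of_ne_nil _ (List.cons_ne_nil p₀ []), List.getLast_singleton,
        List.head_append_of_ne_nil hc₀, hc₁] at this
      exact embDomainGraph_le _ _ _ _ this
    have hadj₂ : (hexDomainGraph Ω δ).Adj q b := by
      rw [e2] at hchain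
      have := hchain.rel_getLast_head_of_append (by simp) (by simp)
      simp only [List.getLast_append_of_ne_nil _ (List.cons_ne_nil p₀ c₀), List.getLast_cons hc₀,
        List.head_cons, hcL] at this
      exact this
    have hc₁Λ : c₁ ∈ Λ₀ := hΛ₀ ω₀ _ (by rw [h₀]; simp [hc₁mem])
    have hc₁pre : c₁ ∉ β₀ ++ [p₀] := fun h => by
      rw [e1] at hnd
      exact List.disjoint_of_nodup_append hnd h (by simp [hc₁mem])
    have hc₁b : c₁ ≠ b := fun h => by
      rw [e1] at hnd
      have := (hnd.of_append_right)
      rw [List.nodup_append] at this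
      exact this.2.2 c₁ hc₁mem b (by simp) h
    have hp₀far : N < dist (hexCenter p₀) z₀ := (hfar_iff _).1 (hβfar p₀ (by simp))
    have hc₁near : dist (hexCenter c₁) z₀ ≤ N := (hfar_ff _).1 hc₁n
    have hc₁far : R ≤ dist (hexCenter c₁) z₀ := by
      have := hedge _ _ hadj₁
      linarith [dist_triangle (hexCenter p₀) (hexCenter c₁) z₀]
    -- the vertex set of the fibre
    have hmemΛ' : ∀ v, v ∈ Λ₀ \ (β₀ ++ [p₀]).toFinset ↔ v ∈ Λ₀ ∧ v ∉ β₀ ++ [p₀] := fun v => by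
      simp only [Finset.mem_sdiff, List.mem_toFinset]
    have hVP : ∀ v : HexVertex, dist (hexCenter v) z₀ < N → v ∈ Λ₀ \ (β₀ ++ [p₀]).toFinset :=
      fun v hvN => (hmemΛ' v).2
        ⟨hdisc v hvN, fun h => by have := (hfar_iff v).1 (hβfar v h); linarith⟩
    have hSU₁ : ∃ u c : HexVertex, s(p₀, c₁) = s(u, c) ∧ hexGraph.Adj u c ∧
        u ∉ Λ₀ \ (β₀ ++ [p₀]).toFinset ∧ c ∈ Λ₀ \ (β₀ ++ [p₀]).toFinset ∧
        c ∈ embMeshDomain hexGraph hexCenter Ω δ ∧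
        dist (hexCenter c) z₀ ≤ N ∧ N < dist (hexCenter u) z₀ :=
      ⟨p₀, c₁, rfl, hadj₁, fun h => ((hmemΛ' _).1 h).2 (by simp),
        (hmemΛ' _).2 ⟨hc₁Λ, hc₁pre⟩, hsupp ω₀ _ (by rw [h₀]; simp [hc₁mem]), hc₁near, hp₀far⟩
    have hAC := hRoot _ s(p₀, c₁) q hVP hSU₁ hadj₂
    have eΛ : (Λ₀ \ (β₀ ++ [p₀]).toFinset) \ ([b] : List HexVertex).toFinset =
        (Λ₀ \ (β₀ ++ [p₀]).toFinset).erase b := by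
      rw [← Finset.sdiff_singleton_eq_erase]; congr 1
    rw [← eΛ] at hAC
    -- the transport of the event to the arc
    have hEA : ∀ α : HexMidEdgeSAW ((Λ₀ \ (β₀ ++ [p₀]).toFinset) \ ([b] : List HexVertex).toFinset)
        s(p₀, c₁) s(q, b),
        α.verts.IsChain (hexDomainGraph Ω δ).Adj → EV (β₀ ++ p₀ :: (α.verts ++ [b])) →
        (⟨polyline α.points⟩ : Curve ℂ).HasTraversals k₀ z₀ n (N / 2) := by
      intro α hαchain hE
      obtain ⟨-, hne, -, hhead, -⟩ :=
        exists_hexDomainSAW_of_hexMidEdgeSAW ω₀ hc₀ h₀ hc₁ hcL α hαchain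
      have hmap : (β₀ ++ p₀ :: (α.verts ++ [b])).map hexCenter =
          (β₀ ++ [p₀]).map hexCenter ++ (α.verts.map hexCenter ++ [hexCenter b]) := by simp
      rw [hEV, hmap] at hE
      have h := hasTraversals_polyline_final (by norm_num : (0 : ℝ) ≤ 1 / 2)
        (by linarith : r + 1 / 2 < R - 1 / 2)
        (dist_hexCenter_hexMidpoint_le (hedge _ _ (embDomainGraph_le _ _ _ _ hadj₂))) hE
        (fun p hp => by
          obtain ⟨v, hv, rfl⟩ := List.mem_map.1 hp
          have := (hfar_iff v).1 (hβfar v hv); linarith)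
        (by
          have hcne : α.verts.map hexCenter ≠ [] := by simpa using hne
          rw [List.head_append_of_ne_nil hcne, List.head_map, hhead]; exact hc₁far)
        (hexMidpoint s(p₀, c₁))
      exact (h.of_le (Nat.le_succ _)).mono' (by linarith) (by linarith)
    -- the fibre described by supports (opaque predicate)
    obtain ⟨P, hP⟩ : ∃ P : HexDomainSAW Ω δ a b → Prop, ∀ ω, P ω ↔ ∃ c : List HexVertex,
        ∃ hc : c ≠ [], ω.walk.support = β₀ ++ p₀ :: (c ++ [b]) ∧ c.head hc = c₁ ∧
          c.getLast hc = q := ⟨_, fun _ => Iff.rfl⟩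
    have hsub₁ : S.filter (fun ω => grp ω = grp ω₀) ⊆ (Finset.univ.filter P).filter
        (fun ω => EV ω.walk.support) := by
      intro ω hω
      rw [Finset.mem_filter] at hω
      obtain ⟨hωS, hωg⟩ := hω
      obtain ⟨β₁, c, q₀, hc, h₁, hg₁, -, -⟩ := hcut ω hωS
      rw [hg₁, hg₀] at hωg
      simp only [Prod.mk.injEq, Option.some.injEq] at hωg
      obtain ⟨rfl, rfl, h3, h4⟩ := hωg
      refine Finset.mem_filter.2 ⟨Finset.mem_filter.2 ⟨Finset.mem_univ _, (hP ω).2 ⟨c, hc, h₁, h3, h4⟩⟩,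
        ?_⟩
      exact (Finset.mem_filter.1 hωS).2
    have hsub₂ : Finset.univ.filter P ⊆ Finset.univ.filter (fun ω => grp ω = grp ω₀) := by
      intro ω hω
      obtain ⟨c, hc, hsupp, hch, hcl⟩ := (hP ω).1 (Finset.mem_filter.1 hω).2
      refine Finset.mem_filter.2 ⟨Finset.mem_univ _, ?_⟩
      have hch' : far (c.head hc) = false := by rw [hch]; exact hc₁n
      rw [hg₀, hgrp, hsupp, takeWhile_eq_of_decomp far _ hc hβfar hch',
        dropWhile_eq_of_decomp far _ hc hβfar hch', List.dropLast_concat, List.dropLast_concat,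
        List.getLast?_concat, List.head?_eq_some_head hc, List.getLast?_eq_some_getLast hc, hch, hcl]
    -- assemble
    have hfib := sum_fibre_event_le ω₀ hc₀ h₀ hc₁ hcL Λ₀ hΛ₀ EV
      (fun α => (⟨polyline α.points⟩ : Curve ℂ).HasTraversals k₀ z₀ n (N / 2)) hEA hx hAC
    rw [Finset.filter_congr (fun ω _ => (hP ω).symm)] at hfib
    calc ∑ ω ∈ S.filter (fun ω => grp ω = grp ω₀), x ^ ω.vertexCount
        ≤ ∑ ω ∈ (Finset.univ.filter P).filter (fun ω => EV ω.walk.support), x ^ ω.vertexCount :=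
          Finset.sum_le_sum_of_subset_of_nonneg hsub₁ fun ω _ _ => hnn ω
      _ ≤ C * ∑ ω ∈ Finset.univ.filter P, x ^ ω.vertexCount := hfib
      _ ≤ C * ∑ ω ∈ Finset.univ.filter (fun ω => grp ω = grp ω₀), x ^ ω.vertexCount :=
          mul_le_mul_of_nonneg_left (Finset.sum_le_sum_of_subset_of_nonneg hsub₂ fun ω _ _ => hnn ω)
            hC
  calc ∑ g ∈ S.image grp, ∑ ω ∈ S.filter (fun ω => grp ω = g), x ^ ω.vertexCount
      ≤ ∑ g ∈ S.image grp, C * ∑ ω ∈ Finset.univ.filter (fun ω => grp ω = g), x ^ ω.vertexCount :=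
        Finset.sum_le_sum key
    _ = C * ∑ g ∈ S.image grp, ∑ ω ∈ Finset.univ.filter (fun ω => grp ω = g), x ^ ω.vertexCount := by
        rw [Finset.mul_sum]
    _ ≤ C * ∑ ω : HexDomainSAW Ω δ a b, x ^ ω.vertexCount :=
        mul_le_mul_of_nonneg_left (Finset.sum_fiberwise_le_sum_of_sum_fiber_nonneg
          fun g _ => Finset.sum_nonneg fun ω _ => hnn ω) hC

end Rooted

end Literature.Probability.RandomPlanarGeometry.SAW

end
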